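import Summits.BirchSwinnertonDyer.BirchSwinnertonDyer.Theorems.ResidualThetaTransportAtTwoThetaTransportResidualSchurAtTwo
import Summits.BirchSwinnertonDyer.BirchSwinnertonDyer.Theorems.ResidualThetaTransportAtTwoDefs
import Literature.NumberTheory.EllipticCurves.SupersingularModPDecompositionImageProofs
import Literature.NumberTheory.EllipticCurves.Kobayashi2003.SignedSelmer
import HarnessLib

/-!
# Sketch (stub-ideation k1·g32, technique «weaken / strengthen») — the STRONGEST PROVABLE FORM of the one LOCAL print
# sentence left in the kernel cone of `stub_cmLambdaLower` (crux (R≥)ᵖ `ResidualThetaCountLowerPureAtTwo`, route RTT)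

The merged print fact «Kato125AB» (STUB-PLAN rev 33 (α), Q173) carries the clause (LAM) `λ_𝒪(𝐇¹/Λz) ≤ λ_𝒪(X₀)`, whose
`⊗ℚ`-justification (k2-g31 (F2)–(F4)) uses at the place `v ∣ 2` the LOCAL sentence
(F4 @ v∣2) «`A_g(ℚ_{∞,𝔭})[2^∞]` is finite (Imai 1975 / Kato 2004 (12.5.1), Rem. 12.7)», i.e. `corank 𝐇²_loc,𝔭 = 0`.
On the habitat this is not merely finite but ZERO, and it is a KERNEL THEOREM from the tree's landed Serre 1972 Prop. 12
(`serre1972_supersingular_decompositionSubgroup_image_holds`): for `W` good supersingular at `2` with `a₂ = 0`, `v ∣ 2`, and ANY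
subgroup `K ≤ Γ_ℚ` containing all commutators (e.g. `κ.kerSubgroup` of a `ℤ₂`-extension, `Γ_ℚ/ker κ ≅ ℤ₂` being abelian),
no non-zero point of `W[2^∞]` is fixed by `U_K := {δ ∈ Γ_{ℚ_v} : res δ ∈ K}`; through the residual datum `Θ` the same holds for
`A_ρ = CofreeF S ρ`, locally and hence globally over `ℚ_∞`.  COMMUTATOR TRICK: `ρ̄_{W,2}(Γ_{ℚ_v}) = GL₂(𝔽₂)` (Serre), so some
`δ₁, δ₂ ∈ Γ_{ℚ_v}` map to the swap and the transvection; `c = [δ₁, δ₂]` restricts into `K` and acts on `W[2] ≅ 𝔽₂²` by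
`!![1,1;1,0]` (order `3`), which fixes only `0`; `2`-power torsion follows by induction on the exponent.
THEOREMS ONLY, no `sorry`, no new definitions of mathematical objects; BSD is NOT proved by any of this; RSL_g / (R≥)ᵖ are NOT
closed by this (price 0 on registered bytes: it replaces a PRINT sentence of a docstring D-audit by a tree theorem).

References: [SerreInventiones1972] §1.11 Prop. 12 (c),(d), §2.2; [Kato2004Asterisque] Thm. 12.5 (1), Rem. 12.7 (pp. 221–223);
[Imai1975] (Proc. Japan Acad. 51) Theorem; [SilvermanAEC2009] III.§7.
-/

set_option autoImplicit false
-- the Cruxes namespace of this sub repeats the summit name by design (D-0017 nested layout)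
set_option linter.dupNamespace false

noncomputable section

open scoped MatrixGroups
open Matrix WeierstrassCurve NumberField Field IsDedekindDomain Literature Literature.NumberTheory.EllipticCurves
  Literature.NumberTheory.GaloisRepresentations Literature.NumberTheory.EllipticCurves.Rank1Residual Rat.HeightOneSpectrum
open Summit.BirchSwinnertonDyer.BirchSwinnertonDyer.Theorems.ThetaTransport
open Summit.BirchSwinnertonDyer.BirchSwinnertonDyer.Theorems.OnePair

namespace Summit.BirchSwinnertonDyer.BirchSwinnertonDyer.Cruxes.ResidualThetaCountLowerPureAtTwo.SideaK1G32

/-! ## H0 — the finite-group core (`decide`) -/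

/-- In `𝔽₂²`, the matrix `!![1,1;1,0]` (an element of order `3` of `GL₂(𝔽₂)`) fixes only the zero vector. [folklore] -/
theorem commMatrix_mulVec_eq_self_imp_eq_zero :
    ∀ w : Fin 2 → ZMod 2, (!![1, 1; 1, 0] : Matrix (Fin 2) (Fin 2) (ZMod 2)) *ᵥ w = w → w = 0 := by
  decide

/-- The swap `!![0,1;1,0]` as a unit of `M₂(𝔽₂)`. [folklore] -/
def gSwap : GL (Fin 2) (ZMod 2) := ⟨!![0, 1; 1, 0], !![0, 1; 1, 0], swap_mul_swap, swap_mul_swap⟩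

/-- The transvection `!![1,1;0,1]` as a unit of `M₂(𝔽₂)`. [folklore] -/
def gTrans : GL (Fin 2) (ZMod 2) :=
  ⟨!![1, 1; 0, 1], !![1, 1; 0, 1], transvection_mul_transvection, transvection_mul_transvection⟩

/-- The commutator `[swap, transvection] = !![1,1;1,0]` in `GL₂(𝔽₂)`. [folklore] -/
theorem val_comm_gSwap_gTrans :
    ((gSwap * gTrans * gSwap⁻¹ * gTrans⁻¹ : GL (Fin 2) (ZMod 2)) : Matrix (Fin 2) (Fin 2) (ZMod 2)) = !![1, 1; 1, 0] := by
  rw [Units.val_mul, Units.val_mul, Units.val_mul]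
  show (!![0, 1; 1, 0] : Matrix (Fin 2) (Fin 2) (ZMod 2)) * !![1, 1; 0, 1] * !![0, 1; 1, 0] * !![1, 1; 0, 1] = !![1, 1; 1, 0]
  decide

/-- Commutators lie in the kernel of a `ℤ_p`-extension character (`Γ_K / ker κ ≅ ℤ_p` is abelian). [folklore] -/
theorem comm_mem_kerSubgroup {p : ℕ} [Fact p.Prime] (κ : ZpExtension ℚ p) (a b : absoluteGaloisGroup ℚ) :
    a * b * a⁻¹ * b⁻¹ ∈ κ.kerSubgroup := by
  rw [ZpExtension.mem_kerSubgroup, map_mul, map_mul, map_mul, map_inv, map_inv, mul_inv_cancel_comm, mul_inv_cancel]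

/-! ## H1 — `W[2]` has no non-zero point fixed by `U_K` -/

variable (W : WeierstrassCurve ℚ) [W.IsElliptic] [W.IsGloballyMinimal]

/-- **No `U_K`-fixed `2`-torsion (granted Serre's fact, as the Schur-at-2 file does).** `W/ℚ` globally minimal, good supersingular
at `2`, `a₂(W) = 0`; `v ∣ 2`; `K ≤ Γ_ℚ` containing every commutator; `P ∈ W[2]` fixed by every `res_v δ ∈ K`
(`δ ∈ Γ_{ℚ_v}`). Then `P = 0`. [cite: SerreInventiones1972, §1.11 Prop. 12 (c),(d); §2.2] -/
theorem geomTorsion_two_eq_zero_of_fixed (hSe : serre1972_supersingular_decompositionSubgroup_image)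
    (hss : GoodSS W 2) (ha2 : W.frobeniusTrace 2 = 0) (v : HeightOneSpectrum (𝓞 ℚ)) (hv : ((2 : ℕ) : 𝓞 ℚ) ∈ v.asIdeal)
    (K : Subgroup (absoluteGaloisGroup ℚ)) (hK : ∀ a b : absoluteGaloisGroup ℚ, a * b * a⁻¹ * b⁻¹ ∈ K)
    (P : geomTorsion W 2)
    (hP : ∀ δ : absoluteGaloisGroup (v.adicCompletion ℚ), absGaloisRestrict ℚ (v.adicCompletion ℚ) δ ∈ K →
      absGaloisRestrict ℚ (v.adicCompletion ℚ) δ • P = P) :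
    P = 0 := by
  classical
  haveI : Fact (Nat.Prime 2) := ⟨Nat.prime_two⟩
  haveI : NeZero ((2 : ℕ) : ℚ) := ⟨by norm_num⟩
  -- a continuous frame of `W[2]`
  obtain ⟨ρ, e, he⟩ := exists_isTorsionGaloisRep W 2
  -- Serre at the prime `𝔓₀` of the chosen embedding (verbatim from the Schur-at-2 file)
  have hv2 : (primesEquiv v : ℕ) = 2 := primesEquiv_eq_of_natCast_mem v Nat.prime_two hv
  have hgood : W.HasGoodReductionAt v := (hasGoodReductionAtPrime_primesEquiv_iff_holds W v 2 hv2).mp hss.1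
  have hdvd : ((2 : ℕ) : ℤ) ∣ W.frobeniusTraceAt v := by
    rw [frobeniusTraceAt_eq_frobeniusTrace, hv2, ha2]; exact dvd_zero _
  obtain ⟨-, -, hcard⟩ := hSe W 2 v hv hgood hdvd ρ ⟨e, he⟩ (adicCompletionPrime ℚ v) (adicCompletionPrime_mem_primesAbove ℚ v)
  have htop : ((adicCompletionPrime ℚ v).decompositionSubgroup (absoluteGaloisGroup ℚ)).map ρ.toMonoidHom = ⊤ := by
    apply Subgroup.eq_top_of_card_eq
    rw [hcard, Literature.Computability.AlgebraicComplexity.card_GL_fin_two_zmod_two]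
    norm_num
  have hsurj : ∀ g : GL (Fin 2) (ZMod 2), ∃ δ : absoluteGaloisGroup (v.adicCompletion ℚ),
      ρ (absGaloisRestrict ℚ (v.adicCompletion ℚ) δ) = g := by
    intro g
    have hg : g ∈ ((adicCompletionPrime ℚ v).decompositionSubgroup (absoluteGaloisGroup ℚ)).map ρ.toMonoidHom := by
      rw [htop]; exact Subgroup.mem_top g
    obtain ⟨σ, hσ, rfl⟩ := hg
    rw [decompositionSubgroup_adicCompletionPrime_eq_range] at hσ
    obtain ⟨δ, rfl⟩ := hσ
    exact ⟨δ, rfl⟩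
  -- the commutator of lifts of the swap and the transvection
  obtain ⟨δ₁, h₁⟩ := hsurj gSwap
  obtain ⟨δ₂, h₂⟩ := hsurj gTrans
  have hcK : absGaloisRestrict ℚ (v.adicCompletion ℚ) (δ₁ * δ₂ * δ₁⁻¹ * δ₂⁻¹) ∈ K := by
    simp only [map_mul, map_inv]; exact hK _ _
  have hfix := hP _ hcK
  have hρc : ((ρ (absGaloisRestrict ℚ (v.adicCompletion ℚ) (δ₁ * δ₂ * δ₁⁻¹ * δ₂⁻¹)) : GL (Fin 2) (ZMod 2)) :
      Matrix (Fin 2) (Fin 2) (ZMod 2)) = !![1, 1; 1, 0] := by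
    simp only [map_mul, map_inv, h₁, h₂]; exact val_comm_gSwap_gTrans
  have hw : (!![1, 1; 1, 0] : Matrix (Fin 2) (Fin 2) (ZMod 2)) *ᵥ e P = e P := by
    rw [← hρc, ← he, hfix]
  have h0 : e P = 0 := commMatrix_mulVec_eq_self_imp_eq_zero (e P) hw
  exact e.injective (h0.trans (map_zero e).symm)

/-! ## H2 — `W[2^∞]` has no non-zero point fixed by `U_K` (induction on the exponent) -/

/-- **No `U_K`-fixed `2`-power torsion** (same hypotheses; `P ∈ W[2^∞]`). [cite: SerreInventiones1972, §1.11 Prop. 12 (c),(d); §2.2]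
[cite: SilvermanAEC2009, III.§7] -/
theorem geomPrimaryTorsion_two_eq_zero_of_fixed (hSe : serre1972_supersingular_decompositionSubgroup_image)
    (hss : GoodSS W 2) (ha2 : W.frobeniusTrace 2 = 0) (v : HeightOneSpectrum (𝓞 ℚ)) (hv : ((2 : ℕ) : 𝓞 ℚ) ∈ v.asIdeal)
    (K : Subgroup (absoluteGaloisGroup ℚ)) (hK : ∀ a b : absoluteGaloisGroup ℚ, a * b * a⁻¹ * b⁻¹ ∈ K)
    (P : ↥(W.geomPrimaryTorsion 2))
    (hP : ∀ δ : absoluteGaloisGroup (v.adicCompletion ℚ), absGaloisRestrict ℚ (v.adicCompletion ℚ) δ ∈ K →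
      absGaloisRestrict ℚ (v.adicCompletion ℚ) δ • P = P) :
    P = 0 := by
  obtain ⟨k, hk⟩ := W.exists_pow_smul_geomPrimaryTorsion_eq_zero (p := 2) P
  induction k with
  | zero => simpa using hk
  | succ k ih =>
    apply ih
    -- `Q := 2^k • P` is a `U_K`-fixed point of `W[2]`, hence `0`
    set Q : ↥(W.geomPrimaryTorsion 2) := 2 ^ k • P with hQdef
    have hQfix : ∀ δ : absoluteGaloisGroup (v.adicCompletion ℚ), absGaloisRestrict ℚ (v.adicCompletion ℚ) δ ∈ K →
        absGaloisRestrict ℚ (v.adicCompletion ℚ) δ • Q = Q := fun δ hδ ↦ by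
      have h2 : absGaloisRestrict ℚ (v.adicCompletion ℚ) δ • (2 ^ k • P) =
          2 ^ k • (absGaloisRestrict ℚ (v.adicCompletion ℚ) δ • P) :=
        map_nsmul (DistribSMul.toAddMonoidHom (↥(W.geomPrimaryTorsion 2)) (absGaloisRestrict ℚ (v.adicCompletion ℚ) δ)) (2 ^ k) P
      rw [hQdef, h2, hP δ hδ]
    have h2Q : 2 • Q = 0 := by rw [hQdef, smul_smul, ← pow_succ', hk]
    have hQmem : (Q : geomPoints W) ∈ geomTorsion W 2 := by
      rw [mem_geomTorsion_iff, two_zsmul, ← two_nsmul, ← AddSubmonoidClass.coe_nsmul, h2Q]; rfl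
    have hQ'fix : ∀ δ : absoluteGaloisGroup (v.adicCompletion ℚ), absGaloisRestrict ℚ (v.adicCompletion ℚ) δ ∈ K →
        absGaloisRestrict ℚ (v.adicCompletion ℚ) δ • (⟨(Q : geomPoints W), hQmem⟩ : geomTorsion W 2) = ⟨(Q : geomPoints W), hQmem⟩ :=
      fun δ hδ ↦ Subtype.ext (by
        rw [Literature.NumberTheory.EllipticCurves.AddSubgroup.torsionBy.coe_smul]
        show absGaloisRestrict ℚ (v.adicCompletion ℚ) δ • (Q : geomPoints W) = (Q : geomPoints W)
        rw [← primaryComponent.coe_smul, hQfix δ hδ])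
    have hQ0 := geomTorsion_two_eq_zero_of_fixed W hSe hss ha2 v hv K hK ⟨(Q : geomPoints W), hQmem⟩ hQ'fix
    have hQ0' : (Q : geomPoints W) = 0 := congrArg Subtype.val hQ0
    exact Subtype.ext hQ0'

/-! ## H3 — through the residual datum `Θ`: `A_ρ = CofreeF S ρ` has no non-zero `U_K`-fixed element, and none over `ℚ_∞` -/

/-- `res_v` in the two dialects of the tree agree (`absGaloisRestrict ℚ ℚ_v = resGalOfEmb (closureEmb ℚ_v)`, definitional). [folklore] -/
theorem absGaloisRestrict_eq_resGalOfEmb (v : HeightOneSpectrum (𝓞 ℚ)) (τ : absoluteGaloisGroup (v.adicCompletion ℚ)) :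
    absGaloisRestrict ℚ (v.adicCompletion ℚ) τ = resGalOfEmb (closureEmb (K := ℚ) (v.adicCompletion ℚ)) τ := by
  rw [← WeierstrassCurve.resGal_eq_absGaloisRestrict]; rfl

/-- **(F4 @ v∣2), kernel form: no `U_K`-fixed element of `A_ρ`.** For the crux's framed `ρ` with residual datum
`Θ_v : A_ρ ≃+ W[2^∞]ⁿ` equivariant for `Γ_{ℚ_v}` (the crux binders `Θ v hv`, `hΘ v hv`), and `K` containing all commutators:
an `m ∈ A_ρ` fixed by every `res_v δ ∈ K` is `0`. In particular `H⁰(ℚ_{∞,v}, A_ρ) = 0`, so Kato's local term `𝐇²_{loc,v}` has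
`λ = corank = 0` EXACTLY (not just «finite»). [cite: SerreInventiones1972, §1.11 Prop. 12] [cite: Kato2004Asterisque, Thm. 12.5 (1), Rem. 12.7] -/
theorem cofreeF_eq_zero_of_fixed {S : Set (PadicAlgCl 2)} (hSe : serre1972_supersingular_decompositionSubgroup_image)
    (hss : GoodSS W 2) (ha2 : W.frobeniusTrace 2 = 0) (v : HeightOneSpectrum (𝓞 ℚ)) (hv : ((2 : ℕ) : 𝓞 ℚ) ∈ v.asIdeal)
    {n : ℕ} (ρ : FramedGaloisRep ℚ (coeffO S) 2) (Θ : CofreeF S ρ ≃+ (Fin n → ↥(W.geomPrimaryTorsion 2)))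
    (hΘ : ∀ (δ : absoluteGaloisGroup (v.adicCompletion ℚ)) (m : CofreeF S ρ) (i : Fin n),
      Θ (resGalOfEmb (closureEmb (K := ℚ) (v.adicCompletion ℚ)) δ • m) i =
        resGalOfEmb (closureEmb (K := ℚ) (v.adicCompletion ℚ)) δ • Θ m i)
    (K : Subgroup (absoluteGaloisGroup ℚ)) (hK : ∀ a b : absoluteGaloisGroup ℚ, a * b * a⁻¹ * b⁻¹ ∈ K)
    (m : CofreeF S ρ)
    (hm : ∀ δ : absoluteGaloisGroup (v.adicCompletion ℚ), resGalOfEmb (closureEmb (K := ℚ) (v.adicCompletion ℚ)) δ ∈ K →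
      resGalOfEmb (closureEmb (K := ℚ) (v.adicCompletion ℚ)) δ • m = m) :
    m = 0 := by
  have hΘm : Θ m = 0 := by
    refine funext fun i ↦ ?_
    show Θ m i = 0
    refine geomPrimaryTorsion_two_eq_zero_of_fixed W hSe hss ha2 v hv K hK (Θ m i) fun δ hδ ↦ ?_
    rw [absGaloisRestrict_eq_resGalOfEmb] at hδ ⊢
    rw [← hΘ, hm δ hδ]
  exact Θ.injective (hΘm.trans (map_zero Θ).symm)

/-- **Globally over `ℚ_∞`: `H⁰(ker κ, A_ρ) = 0`** for every `ℤ₂`-extension `κ` of `ℚ` (commutators lie in `ker κ`), on the habitat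
and through `Θ_v` — UNCONDITIONALLY in Ribet-type irreducibility (compare K0b clause (b)'s kernel, which imports «`ρ ⊗ ℚ̄₂`
irreducible with non-abelian image»). [cite: SerreInventiones1972, §1.11 Prop. 12] [cite: Kato2004Asterisque, Thm. 12.4 (3), §13.8] -/
theorem cofreeF_eq_zero_of_fixed_kerSubgroup {S : Set (PadicAlgCl 2)}
    (hSe : serre1972_supersingular_decompositionSubgroup_image)
    (hss : GoodSS W 2) (ha2 : W.frobeniusTrace 2 = 0) (v : HeightOneSpectrum (𝓞 ℚ)) (hv : ((2 : ℕ) : 𝓞 ℚ) ∈ v.asIdeal)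
    {n : ℕ} (ρ : FramedGaloisRep ℚ (coeffO S) 2) (Θ : CofreeF S ρ ≃+ (Fin n → ↥(W.geomPrimaryTorsion 2)))
    (hΘ : ∀ (δ : absoluteGaloisGroup (v.adicCompletion ℚ)) (m : CofreeF S ρ) (i : Fin n),
      Θ (resGalOfEmb (closureEmb (K := ℚ) (v.adicCompletion ℚ)) δ • m) i =
        resGalOfEmb (closureEmb (K := ℚ) (v.adicCompletion ℚ)) δ • Θ m i)
    (κ : ZpExtension ℚ 2) (m : CofreeF S ρ) (hm : ∀ σ : absoluteGaloisGroup ℚ, σ ∈ κ.kerSubgroup → σ • m = m) :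
    m = 0 :=
  cofreeF_eq_zero_of_fixed W hSe hss ha2 v hv ρ Θ hΘ κ.kerSubgroup (comm_mem_kerSubgroup κ) m fun _ hδ ↦ hm _ hδ

/-! ## H4 — unconditional forms (Serre's fact is a tree theorem: `serre1972_supersingular_decompositionSubgroup_image_holds`) -/

/-- **(F4 @ v∣2) unconditional on the habitat.** [cite: SerreInventiones1972, §1.11 Prop. 12 (c),(d); §2.2] -/
theorem cofreeF_eq_zero_of_fixed' {S : Set (PadicAlgCl 2)}
    (hss : GoodSS W 2) (ha2 : W.frobeniusTrace 2 = 0) (v : HeightOneSpectrum (𝓞 ℚ)) (hv : ((2 : ℕ) : 𝓞 ℚ) ∈ v.asIdeal)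
    {n : ℕ} (ρ : FramedGaloisRep ℚ (coeffO S) 2) (Θ : CofreeF S ρ ≃+ (Fin n → ↥(W.geomPrimaryTorsion 2)))
    (hΘ : ∀ (δ : absoluteGaloisGroup (v.adicCompletion ℚ)) (m : CofreeF S ρ) (i : Fin n),
      Θ (resGalOfEmb (closureEmb (K := ℚ) (v.adicCompletion ℚ)) δ • m) i =
        resGalOfEmb (closureEmb (K := ℚ) (v.adicCompletion ℚ)) δ • Θ m i)
    (K : Subgroup (absoluteGaloisGroup ℚ)) (hK : ∀ a b : absoluteGaloisGroup ℚ, a * b * a⁻¹ * b⁻¹ ∈ K)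
    (m : CofreeF S ρ)
    (hm : ∀ δ : absoluteGaloisGroup (v.adicCompletion ℚ), resGalOfEmb (closureEmb (K := ℚ) (v.adicCompletion ℚ)) δ ∈ K →
      resGalOfEmb (closureEmb (K := ℚ) (v.adicCompletion ℚ)) δ • m = m) :
    m = 0 :=
  cofreeF_eq_zero_of_fixed W serre1972_supersingular_decompositionSubgroup_image_holds hss ha2 v hv ρ Θ hΘ K hK m hm

/-- **`W(ℚ_v)[2^∞] = 0`, indeed no `Γ_{ℚ_v}`-fixed `2`-power torsion at all** (`K = ⊤`), unconditional on the habitat.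
[cite: SerreInventiones1972, §1.11 Prop. 12 (c),(d)] -/
theorem geomPrimaryTorsion_two_eq_zero_of_fixed_local (hss : GoodSS W 2) (ha2 : W.frobeniusTrace 2 = 0)
    (v : HeightOneSpectrum (𝓞 ℚ)) (hv : ((2 : ℕ) : 𝓞 ℚ) ∈ v.asIdeal) (P : ↥(W.geomPrimaryTorsion 2))
    (hP : ∀ δ : absoluteGaloisGroup (v.adicCompletion ℚ), absGaloisRestrict ℚ (v.adicCompletion ℚ) δ • P = P) : P = 0 :=
  geomPrimaryTorsion_two_eq_zero_of_fixed W serre1972_supersingular_decompositionSubgroup_image_holds hss ha2 v hv ⊤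
    (fun _ _ ↦ Subgroup.mem_top _) P fun δ _ ↦ hP δ


/-- **`H⁰(ℚ_{∞,v}, A_ρ) = 0` in the crux's own vocabulary** (`localSubgroupOfEmb κ.kerSubgroup (closureEmb ℚ_v)` = the absolute Galois
group of the local cyclotomic tower `ℚ_{∞,v}`, as in `OnePairPins.mem_Sel₀_iff` / `plusSelmerSet`), unconditional on the habitat: an element of
`A_ρ` fixed by the local tower group is `0`. This is (F4 @ v∣2) of the (LAM) clause's `⊗ℚ`-derivation as a TREE THEOREM (exact zero, not
just Imai-finiteness). [cite: SerreInventiones1972, §1.11 Prop. 12 (c),(d)] [cite: Kato2004Asterisque, Thm. 12.5 (1), Rem. 12.7] [cite: Imai1975, Theorem] -/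
theorem cofreeF_eq_zero_of_fixed_localTower {S : Set (PadicAlgCl 2)}
    (hss : GoodSS W 2) (ha2 : W.frobeniusTrace 2 = 0) (v : HeightOneSpectrum (𝓞 ℚ)) (hv : ((2 : ℕ) : 𝓞 ℚ) ∈ v.asIdeal)
    {n : ℕ} (ρ : FramedGaloisRep ℚ (coeffO S) 2) (Θ : CofreeF S ρ ≃+ (Fin n → ↥(W.geomPrimaryTorsion 2)))
    (hΘ : ∀ (δ : absoluteGaloisGroup (v.adicCompletion ℚ)) (m : CofreeF S ρ) (i : Fin n),
      Θ (resGalOfEmb (closureEmb (K := ℚ) (v.adicCompletion ℚ)) δ • m) i =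
        resGalOfEmb (closureEmb (K := ℚ) (v.adicCompletion ℚ)) δ • Θ m i)
    (κ : ZpExtension ℚ 2) (m : CofreeF S ρ)
    (hm : ∀ τ : absoluteGaloisGroup (v.adicCompletion ℚ),
      τ ∈ localSubgroupOfEmb κ.kerSubgroup (closureEmb (K := ℚ) (v.adicCompletion ℚ)) →
        resGalOfEmb (closureEmb (K := ℚ) (v.adicCompletion ℚ)) τ • m = m) :
    m = 0 :=
  cofreeF_eq_zero_of_fixed' W hss ha2 v hv ρ Θ hΘ κ.kerSubgroup (comm_mem_kerSubgroup κ) m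
    fun τ hτ ↦ hm τ ((mem_localSubgroupOfEmb_iff κ.kerSubgroup (closureEmb (K := ℚ) (v.adicCompletion ℚ)) τ).mpr hτ)

/-! ## H5 — every FINITE local layer: `H⁰(ℚ_{n,v}, W[2^∞]) = 0` and `H⁰(ℚ_{n,v}, A_ρ) = 0` (the levelwise input of the
Bockstein / Perrin-Riou torsion formula for `𝐇²_loc`, cf. `Kato2004/LocalIwasawaCohomology.lean` §12.2 (12.2.3) docstring) -/

/-- Commutators lie in every layer subgroup `κ⁻¹(pⁿℤ_p)` (`Γ_K/Γ_n ≅ ℤ/pⁿ` is abelian). [folklore] -/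
theorem comm_mem_layerSubgroup {p : ℕ} [Fact p.Prime] (κ : ZpExtension ℚ p) (n : ℕ) (a b : absoluteGaloisGroup ℚ) :
    a * b * a⁻¹ * b⁻¹ ∈ κ.layerSubgroup n := by
  rw [ZpExtension.mem_layerSubgroup, (ZpExtension.mem_kerSubgroup).mp (comm_mem_kerSubgroup κ a b), toAdd_one]
  exact dvd_zero _

/-- **`W(ℚ_{n,v})[2^∞] = 0` for EVERY finite layer `ℚ_{n,v}` of the local cyclotomic `ℤ₂`-tower** (Kobayashi's `U_n =
localLayerSubgroupOfEmb κ (closureEmb ℚ_v) n`), unconditional on the habitat. [cite: SerreInventiones1972, §1.11 Prop. 12 (c),(d)]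
[cite: Kobayashi2003, Def. 1.1] -/
theorem geomPrimaryTorsion_two_eq_zero_of_fixed_layer (hss : GoodSS W 2) (ha2 : W.frobeniusTrace 2 = 0)
    (v : HeightOneSpectrum (𝓞 ℚ)) (hv : ((2 : ℕ) : 𝓞 ℚ) ∈ v.asIdeal) (κ : ZpExtension ℚ 2) (n : ℕ)
    (P : ↥(W.geomPrimaryTorsion 2))
    (hP : ∀ τ : absoluteGaloisGroup (v.adicCompletion ℚ),
      τ ∈ Kobayashi2003.localLayerSubgroupOfEmb κ (closureEmb (K := ℚ) (v.adicCompletion ℚ)) n →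
        absGaloisRestrict ℚ (v.adicCompletion ℚ) τ • P = P) :
    P = 0 :=
  geomPrimaryTorsion_two_eq_zero_of_fixed W serre1972_supersingular_decompositionSubgroup_image_holds hss ha2 v hv
    (κ.layerSubgroup n) (comm_mem_layerSubgroup κ n) P fun τ hτ ↦ hP τ
      ((mem_localSubgroupOfEmb_iff (κ.layerSubgroup n) (closureEmb (K := ℚ) (v.adicCompletion ℚ)) τ).mpr
        (by rwa [absGaloisRestrict_eq_resGalOfEmb] at hτ))

/-- **`H⁰(ℚ_{n,v}, A_ρ) = 0` for EVERY finite layer** of the local cyclotomic `ℤ₂`-tower, through the residual datum `Θ_v`,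
unconditional on the habitat. [cite: SerreInventiones1972, §1.11 Prop. 12 (c),(d)] [cite: Kato2004Asterisque, §12.2 (12.2.3), Rem. 12.7]
[cite: Kobayashi2003, Def. 1.1] -/
theorem cofreeF_eq_zero_of_fixed_layer {S : Set (PadicAlgCl 2)}
    (hss : GoodSS W 2) (ha2 : W.frobeniusTrace 2 = 0) (v : HeightOneSpectrum (𝓞 ℚ)) (hv : ((2 : ℕ) : 𝓞 ℚ) ∈ v.asIdeal)
    {n : ℕ} (ρ : FramedGaloisRep ℚ (coeffO S) 2) (Θ : CofreeF S ρ ≃+ (Fin n → ↥(W.geomPrimaryTorsion 2)))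
    (hΘ : ∀ (δ : absoluteGaloisGroup (v.adicCompletion ℚ)) (m : CofreeF S ρ) (i : Fin n),
      Θ (resGalOfEmb (closureEmb (K := ℚ) (v.adicCompletion ℚ)) δ • m) i =
        resGalOfEmb (closureEmb (K := ℚ) (v.adicCompletion ℚ)) δ • Θ m i)
    (κ : ZpExtension ℚ 2) (k : ℕ) (m : CofreeF S ρ)
    (hm : ∀ τ : absoluteGaloisGroup (v.adicCompletion ℚ),
      τ ∈ Kobayashi2003.localLayerSubgroupOfEmb κ (closureEmb (K := ℚ) (v.adicCompletion ℚ)) k →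
        resGalOfEmb (closureEmb (K := ℚ) (v.adicCompletion ℚ)) τ • m = m) :
    m = 0 :=
  cofreeF_eq_zero_of_fixed' W hss ha2 v hv ρ Θ hΘ (κ.layerSubgroup k) (comm_mem_layerSubgroup κ k) m
    fun τ hτ ↦ hm τ ((mem_localSubgroupOfEmb_iff (κ.layerSubgroup k) (closureEmb (K := ℚ) (v.adicCompletion ℚ)) τ).mpr hτ)

end Summit.BirchSwinnertonDyer.BirchSwinnertonDyer.Cruxes.ResidualThetaCountLowerPureAtTwo.SideaK1G32

end
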